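import Mathlib.Analysis.Calculus.UniformLimitsDeriv
import Mathlib.Analysis.Calculus.ContDiff.Bounds
import Mathlib.Analysis.Calculus.MeanValue
import Mathlib.Topology.MetricSpace.Cauchy
import HarnessLib

/-!
# Smooth limits from uniform `C⁰` convergence and uniform `C^k` bounds

Analysis/FunctionSpaces support file. The device that lets a Picard iteration be estimated only
at level zero for *differences* while all higher derivatives are merely *bounded* uniformly:

* `norm_fderiv_le_of_interpolation` — the elementary Landau–Kolmogorov interpolation
  `‖Dg(x)‖ ≤ 2ε/ρ + Bρ` (`ρ > 0`) for `‖g‖ ≤ ε` with `B`-Lipschitz derivative;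
* `norm_iteratedFDeriv_sub_le_of_bound` — `D^{n+1} h` is `B`-Lipschitz if `‖D^{n+2} h‖ ≤ B`;
* `uniformCauchy_iteratedFDeriv` — smooth `(f_m)`, uniformly Cauchy in sup norm, with
  `‖D^n f_m‖ ≤ B_n` uniformly in `m`: every `(D^n f_m)_m` is uniformly Cauchy (induction on `n`);
* `exists_contDiff_limit` — hence (complete codomain) `f_m → g` with `g` smooth, all derivatives
  converging uniformly (`hasFDerivAt_of_tendstoUniformly`, `HasFTaylorSeriesUpTo.contDiff`),
  and the uniform bounds passing to the limit.

Everything is proved; theorems only.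

## References

* L. Hörmander, *The Analysis of Linear Partial Differential Operators I*, 2nd ed. (1990),
  Thm. 1.1.5 ff. (limits of smooth functions); E. Landau, Proc. LMS 13 (1913) (interpolation).
-/

noncomputable section

open Set Filter Topology Metric
open scoped ContDiff

namespace Literature.Analysis.FunctionSpaces

variable {X : Type*} [NormedAddCommGroup X] [NormedSpace ℝ X]
variable {F : Type*} [NormedAddCommGroup F] [NormedSpace ℝ F]

/-- **Interpolation between a sup bound and a Lipschitz bound on the derivative** (the
elementary Landau–Kolmogorov inequality): if `‖g‖ ≤ ε` everywhere and `Dg` is `B`-Lipschitz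
(`B ≥ 0`), then `‖Dg(x)‖ ≤ 2ε/ρ + Bρ` for every `ρ > 0` (second-order Taylor estimate
`‖g(x+h) - g(x) - Dg(x)h‖ ≤ B‖h‖²` from the mean value inequality). [folklore] -/
theorem norm_fderiv_le_of_interpolation {g : X → F} (hg : Differentiable ℝ g) {B ε : ℝ} (hB0 : 0 ≤ B)
    (hB : ∀ x y, ‖fderiv ℝ g x - fderiv ℝ g y‖ ≤ B * ‖x - y‖) (hε : ∀ x, ‖g x‖ ≤ ε) {ρ : ℝ}
    (hρ : 0 < ρ) (x : X) : ‖fderiv ℝ g x‖ ≤ 2 * ε / ρ + B * ρ := by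
  have hε0 : 0 ≤ ε := (norm_nonneg _).trans (hε x)
  -- second-order Taylor estimate
  have htaylor : ∀ h : X, ‖fderiv ℝ g x h‖ ≤ 2 * ε + B * ‖h‖ ^ 2 := by
    intro h
    set φ : X → F := fun y => g y - fderiv ℝ g x y with hφ
    have hφd : ∀ y, DifferentiableAt ℝ φ y := fun y =>
      (hg y).sub ((fderiv ℝ g x).differentiableAt)
    have hφ' : ∀ y, fderiv ℝ φ y = fderiv ℝ g y - fderiv ℝ g x := fun y => by
      have h := ((hg y).hasFDerivAt.sub (fderiv ℝ g x).hasFDerivAt)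
      exact h.fderiv
    have hbound : ∀ y ∈ closedBall x ‖h‖, ‖fderiv ℝ φ y‖ ≤ B * ‖h‖ := fun y hy => by
      rw [hφ' y]
      refine (hB y x).trans (mul_le_mul_of_nonneg_left ?_ hB0)
      rwa [mem_closedBall, dist_eq_norm] at hy
    have hmv := Convex.norm_image_sub_le_of_norm_fderiv_le (fun y _ => hφd y) hbound (convex_closedBall x ‖h‖)
      (mem_closedBall_self (norm_nonneg h)) (y := x + h) (by rw [mem_closedBall, dist_eq_norm, add_sub_cancel_left])
    rw [add_sub_cancel_left] at hmv
    have hid : φ (x + h) - φ x = g (x + h) - g x - fderiv ℝ g x h := by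
      simp only [hφ, map_add]; abel
    rw [hid] at hmv
    calc ‖fderiv ℝ g x h‖ = ‖(g (x + h) - g x) - (g (x + h) - g x - fderiv ℝ g x h)‖ := by
          congr 1; abel
      _ ≤ ‖g (x + h) - g x‖ + ‖g (x + h) - g x - fderiv ℝ g x h‖ := norm_sub_le _ _
      _ ≤ (‖g (x + h)‖ + ‖g x‖) + B * ‖h‖ * ‖h‖ := add_le_add (norm_sub_le _ _) hmv
      _ ≤ (ε + ε) + B * ‖h‖ * ‖h‖ := by gcongr <;> exact hε _
      _ = 2 * ε + B * ‖h‖ ^ 2 := by ring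
  -- the operator norm
  refine ContinuousLinearMap.opNorm_le_bound _ (by positivity) fun u => ?_
  by_cases hu : u = 0
  · simp [hu]
  · have hu0 : 0 < ‖u‖ := norm_pos_iff.2 hu
    set c : ℝ := ρ / ‖u‖ with hc
    have hc0 : 0 < c := div_pos hρ hu0
    have hnorm : ‖c • u‖ = ρ := by
      rw [norm_smul, Real.norm_eq_abs, abs_of_pos hc0, hc, div_mul_cancel₀ _ hu0.ne']
    have h1 := htaylor (c • u)
    rw [map_smul, norm_smul, Real.norm_eq_abs, abs_of_pos hc0, hnorm] at h1
    -- `c ‖Dg u‖ ≤ 2ε + Bρ²`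
    have h2 : ‖fderiv ℝ g x u‖ ≤ (2 * ε + B * ρ ^ 2) / c := by
      rw [le_div_iff₀ hc0, mul_comm]; exact h1
    calc ‖fderiv ℝ g x u‖ ≤ (2 * ε + B * ρ ^ 2) / c := h2
      _ = (2 * ε / ρ + B * ρ) * ‖u‖ := by
          rw [hc]; field_simp
      _ = _ := rfl

/-- **Lipschitz bound on an iterated derivative from a bound on the next one** (mean value
inequality for `iteratedFDeriv (n+1) h`, whose derivative has the norm of
`iteratedFDeriv (n+2) h`). [folklore] -/
theorem norm_iteratedFDeriv_sub_le_of_bound {h : X → F} {n : ℕ} (hh : ContDiff ℝ (n + 2) h) {B : ℝ}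
    (hB : ∀ x, ‖iteratedFDeriv ℝ (n + 2) h x‖ ≤ B) (x y : X) :
    ‖iteratedFDeriv ℝ (n + 1) h x - iteratedFDeriv ℝ (n + 1) h y‖ ≤ B * ‖x - y‖ := by
  have hd : Differentiable ℝ (iteratedFDeriv ℝ (n + 1) h) :=
    hh.differentiable_iteratedFDeriv (m := n + 1) (by exact_mod_cast Nat.lt_succ_self (n + 1))
  have hbound : ∀ z ∈ (univ : Set X), ‖fderiv ℝ (iteratedFDeriv ℝ (n + 1) h) z‖ ≤ B := fun z _ => by
    rw [norm_fderiv_iteratedFDeriv]; exact hB z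
  exact Convex.norm_image_sub_le_of_norm_fderiv_le (fun z _ => hd z) hbound convex_univ (mem_univ y) (mem_univ x)

/-- **Uniform Cauchy property of all derivatives from the `C⁰` one and uniform `C^k` bounds.**
If `(f_m)` are smooth, uniformly Cauchy in sup norm, and `‖D^n f_m‖ ≤ B_n` uniformly in `m` for
every `n`, then for every `n` the sequence `(D^n f_m)` is uniformly Cauchy (interpolation,
`norm_fderiv_le_of_interpolation`, inductively in `n`). [folklore] -/
theorem uniformCauchy_iteratedFDeriv {f : ℕ → X → F} (hf : ∀ m, ContDiff ℝ ∞ (f m))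
    (hB : ∀ n : ℕ, ∃ B : ℝ, ∀ m x, ‖iteratedFDeriv ℝ n (f m) x‖ ≤ B)
    (h0 : ∀ ε > 0, ∃ N, ∀ m ≥ N, ∀ m' ≥ N, ∀ x, ‖f m x - f m' x‖ ≤ ε) (n : ℕ) :
    ∀ ε > 0, ∃ N, ∀ m ≥ N, ∀ m' ≥ N, ∀ x,
      ‖iteratedFDeriv ℝ n (f m) x - iteratedFDeriv ℝ n (f m') x‖ ≤ ε := by
  have hfn : ∀ m (k : ℕ), ContDiff ℝ k (f m) := fun m k => (hf m).of_le (by exact_mod_cast le_top)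
  induction n with
  | zero =>
    intro ε hε
    obtain ⟨N, hN⟩ := h0 ε hε
    refine ⟨N, fun m hm m' hm' x => ?_⟩
    rw [← iteratedFDeriv_sub_apply (hfn m 0).contDiffAt (hfn m' 0).contDiffAt, norm_iteratedFDeriv_zero]
    exact hN m hm m' hm' x
  | succ n ih =>
    intro ε hε
    obtain ⟨B, hBb⟩ := hB (n + 2)
    set B' : ℝ := max B 0 with hB'
    have hB'0 : 0 ≤ B' := le_max_right _ _
    -- parameters: `ρ = ε/(4B'+4)`, `ε₀ = ε ρ/4`
    set ρ : ℝ := ε / (4 * B' + 4) with hρ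
    have hρ0 : 0 < ρ := by positivity
    set ε₀ : ℝ := ε * ρ / 4 with hε₀
    have hε₀0 : 0 < ε₀ := by positivity
    obtain ⟨N, hN⟩ := ih ε₀ hε₀0
    refine ⟨N, fun m hm m' hm' x => ?_⟩
    -- the difference `φ = f m - f m'` and `g = D^n φ`
    set φ : X → F := f m - f m' with hφ
    have hφs : ContDiff ℝ ∞ φ := (hf m).sub (hf m')
    have hφk : ∀ k : ℕ, ContDiff ℝ k φ := fun k => hφs.of_le (by exact_mod_cast le_top)
    have hDφ : ∀ (k : ℕ) (y : X), iteratedFDeriv ℝ k φ y = iteratedFDeriv ℝ k (f m) y - iteratedFDeriv ℝ k (f m') y :=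
      fun k y => iteratedFDeriv_sub_apply (hfn m k).contDiffAt (hfn m' k).contDiffAt
    set g : X → (X [×n]→L[ℝ] F) := iteratedFDeriv ℝ n φ with hg
    have hgd : Differentiable ℝ g := hφs.differentiable_iteratedFDeriv (m := n) (by exact_mod_cast ENat.coe_lt_top n)
    -- sup bound on `g`
    have hgε : ∀ y, ‖g y‖ ≤ ε₀ := fun y => by rw [hg, hDφ]; exact hN m hm m' hm' y
    -- Lipschitz bound on `Dg` through `D^{n+2} φ`
    have hφ2 : ∀ y, ‖iteratedFDeriv ℝ (n + 2) φ y‖ ≤ 2 * B' := fun y => by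
      rw [hDφ]
      calc ‖iteratedFDeriv ℝ (n + 2) (f m) y - iteratedFDeriv ℝ (n + 2) (f m') y‖
          ≤ ‖iteratedFDeriv ℝ (n + 2) (f m) y‖ + ‖iteratedFDeriv ℝ (n + 2) (f m') y‖ := norm_sub_le _ _
        _ ≤ B' + B' := add_le_add ((hBb m y).trans (le_max_left _ _)) ((hBb m' y).trans (le_max_left _ _))
        _ = 2 * B' := by ring
    have hlip := norm_iteratedFDeriv_sub_le_of_bound (hφk (n + 2)) hφ2
    have hDg : ∀ y y', ‖fderiv ℝ g y - fderiv ℝ g y'‖ ≤ 2 * B' * ‖y - y'‖ := fun y y' => by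
      have e : ∀ z, fderiv ℝ g z = (continuousMultilinearCurryLeftEquiv ℝ (fun _ : Fin (n + 1) => X) F)
          (iteratedFDeriv ℝ (n + 1) φ z) := fun z => by
        rw [hg, fderiv_iteratedFDeriv]; rfl
      set Lc := (continuousMultilinearCurryLeftEquiv ℝ (fun _ : Fin (n + 1) => X) F) with hLc
      rw [e, e, ← Lc.map_sub, Lc.norm_map]
      exact hlip y y'
    have hint := norm_fderiv_le_of_interpolation hgd (by positivity) hDg hgε hρ0 x
    -- translate back
    have hnorm : ‖fderiv ℝ g x‖ = ‖iteratedFDeriv ℝ (n + 1) (f m) x - iteratedFDeriv ℝ (n + 1) (f m') x‖ := by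
      rw [hg, norm_fderiv_iteratedFDeriv, hDφ]
    rw [← hnorm]
    refine hint.trans ?_
    have h1 : 2 * ε₀ / ρ = ε / 2 := by
      rw [hε₀]; field_simp; norm_num
    have h2 : 2 * B' * ρ ≤ ε / 2 := by
      rw [hρ, mul_div_assoc', div_le_div_iff₀ (by positivity) (by positivity)]
      nlinarith
    calc 2 * ε₀ / ρ + 2 * B' * ρ ≤ ε / 2 + ε / 2 := by rw [h1]; exact add_le_add le_rfl h2
      _ = ε := by ring

variable [CompleteSpace F]

/-- **Smooth limit theorem.** A sequence of smooth functions which is uniformly Cauchy in sup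
norm and has uniformly bounded derivatives of all orders converges, with all its derivatives,
uniformly to a smooth function, whose derivatives obey the same bounds. [folklore] -/
theorem exists_contDiff_limit {f : ℕ → X → F} (hf : ∀ m, ContDiff ℝ ∞ (f m))
    (hB : ∀ n : ℕ, ∃ B : ℝ, ∀ m x, ‖iteratedFDeriv ℝ n (f m) x‖ ≤ B)
    (h0 : ∀ ε > 0, ∃ N, ∀ m ≥ N, ∀ m' ≥ N, ∀ x, ‖f m x - f m' x‖ ≤ ε) :
    ∃ g : X → F, ContDiff ℝ ∞ g ∧
      (∀ n : ℕ, TendstoUniformly (fun m => iteratedFDeriv ℝ n (f m)) (iteratedFDeriv ℝ n g) atTop) ∧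
      (∀ x, Tendsto (fun m => f m x) atTop (𝓝 (g x))) ∧
      ∀ (n : ℕ) (C : ℝ) (x : X), (∀ m, ‖iteratedFDeriv ℝ n (f m) x‖ ≤ C) → ‖iteratedFDeriv ℝ n g x‖ ≤ C := by
  have hC := uniformCauchy_iteratedFDeriv hf hB h0
  -- uniform Cauchy sequences of the derivatives
  have hUC : ∀ n : ℕ, UniformCauchySeqOn (fun m => iteratedFDeriv ℝ n (f m)) atTop univ := by
    intro n
    rw [Metric.uniformCauchySeqOn_iff]
    intro ε hε
    obtain ⟨N, hN⟩ := hC n (ε / 2) (half_pos hε)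
    exact ⟨N, fun m hm m' hm' x _ => by
      rw [dist_eq_norm]; exact (hN m hm m' hm' x).trans_lt (half_lt_self hε)⟩
  -- pointwise limits
  have hpt : ∀ (n : ℕ) (x : X), ∃ y, Tendsto (fun m => iteratedFDeriv ℝ n (f m) x) atTop (𝓝 y) :=
    fun n x => cauchySeq_tendsto_of_complete ((hUC n).cauchySeq (mem_univ x))
  choose G hG using hpt
  have hTU : ∀ n : ℕ, TendstoUniformly (fun m => iteratedFDeriv ℝ n (f m)) (G n) atTop := fun n => by
    rw [← tendstoUniformlyOn_univ]
    exact (hUC n).tendstoUniformlyOn_of_tendsto fun x _ => hG n x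
  -- the limit function and its Taylor series
  set p : X → FormalMultilinearSeries ℝ X F := fun x n => G n x with hp
  set g : X → F := fun x => (G 0 x).curry0 with hgdef
  have hTaylor : HasFTaylorSeriesUpTo ∞ g p := by
    rw [hasFTaylorSeriesUpTo_top_iff' le_rfl]
    refine ⟨fun x => rfl, fun n x => ?_⟩
    -- `HasFDerivAt (G n) (G (n+1) x).curryLeft x` from the uniform limit of derivatives
    have hder : ∀ (m : ℕ) (y : X), HasFDerivAt (iteratedFDeriv ℝ n (f m))
        ((continuousMultilinearCurryLeftEquiv ℝ (fun _ : Fin (n + 1) => X) F) (iteratedFDeriv ℝ (n + 1) (f m) y)) y := by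
      intro m y
      have hd : Differentiable ℝ (iteratedFDeriv ℝ n (f m)) :=
        (hf m).differentiable_iteratedFDeriv (m := n) (by exact_mod_cast ENat.coe_lt_top n)
      have h := (hd y).hasFDerivAt
      rw [fderiv_iteratedFDeriv] at h
      exact h
    have hunif : TendstoUniformly (fun m y => (continuousMultilinearCurryLeftEquiv ℝ (fun _ : Fin (n + 1) => X) F)
        (iteratedFDeriv ℝ (n + 1) (f m) y))
        (fun y => (continuousMultilinearCurryLeftEquiv ℝ (fun _ : Fin (n + 1) => X) F) (G (n + 1) y)) atTop :=
      (continuousMultilinearCurryLeftEquiv ℝ (fun _ : Fin (n + 1) => X) F).toContinuousLinearEquiv.toContinuousLinearMap.uniformContinuous.comp_tendstoUniformly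
        (hTU (n + 1))
    exact hasFDerivAt_of_tendstoUniformly hunif hder (fun y => hG n y) x
  have hgs : ContDiff ℝ ∞ g := hTaylor.contDiff
  have hGeq : ∀ n : ℕ, iteratedFDeriv ℝ n g = G n := fun n => by
    funext x; exact (hTaylor.eq_iteratedFDeriv (m := n) (by exact_mod_cast le_top) x).symm
  refine ⟨g, hgs, fun n => by rw [hGeq]; exact hTU n, fun x => ?_, fun n C x hCx => ?_⟩
  · -- values converge: `f m x = (D^0 f_m x).curry0`
    have hc : Continuous fun M : X [×0]→L[ℝ] F => M.curry0 :=
      (continuousMultilinearCurryFin0 ℝ X F).continuous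
    have h := (hc.tendsto (G 0 x)).comp (hG 0 x)
    refine h.congr fun m => ?_
    simp only [Function.comp_apply, iteratedFDeriv_zero_apply, ContinuousMultilinearMap.curry0_apply]
  · rw [hGeq]
    exact le_of_tendsto ((hG n x).norm) (Eventually.of_forall hCx)

end Literature.Analysis.FunctionSpaces

end
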